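import Summits.QuantumFields.BalabanUV.Beta.GAN24.W3PinCountdown
import Summits.QuantumFields.BalabanUV.Beta.GAN24.T2ShapeThreeOfPin

/-!
# `BalabanUV.Beta.GAN24.W3PinLock` — binder row G-an2-4 / (CONV-C), W-slot road «W3»: **an2's SECOND-ORDER LOCK (W-L-2) IS THE EXACT PIN —
# ONE ROW, TWO CONSUMERS, AS AN IMPORTABLE TREE LEMMA** (G-an2-4 formalisation swarm, leaf prover 06, gen 12; journal INTENT «W3-PIN-LOCK*» l.11930)

NOT IN PRINT; OUR BOOKKEEPING ([folklore] arithmetic over the tree's weight DEFINITIONS + composition BY NAME; zero analytic content added).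
RECORD OF THE IDENTIFICATION: referee ref2 round 73, R73-1 (`REFEREE-GAN24.md` l.917–942; probe `…-ref2/gen37/Ref2AxR73.lean` f5c4e5ad6091d483 —
`Ref2R73.lock2_iff_pinEq` ∕ `lock2_pos` ∕ `ref2_Wpair_of_lock2`), anticipated by leaf-13-g29's cross-read TEST 4 (journal l.11559, `lock_iff` ∕
`gan24_pinEq_of_D1_pin_and_lock`) and re-derived by asym1-g37's seam probe (journal l.11942, `SeamLock2Pin.lean` 8690e903f1c30634).  All three are
SCRATCH probes; this module is the GAN24-side tree filing a prover seat owes them, so that ref2 R73-2's wording of the pin row's second consumer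
(«(W-L-2) via `lock2_iff_pinEq`») and the carver's `WSlotAssembly.v3` (journal l.11900, NEXT) can cite the identification BY NAME without importing the
D1 spine chain.  ON THE D1 SIDE the per-level form of record is an2-g18's OWN `SpineRooted.lock2_iff` ∕ `lock2_of_bcj2` (`Beta/SecondOrderLockPin`
p216648, landed 11:31Z, numeral currency `cE₂ = Lc^8`; an2 keeps naming precedence there — typer v3.17); `lock2_iff_pow_eight` ∕ `pinEq_iff_pow_eight`
below pass between the two currencies, so the two modules agree wherever both are imported (neither imports the other).

HONEST FRAMING (cell contract, verbatim): «discharging `BetaPertH` makes Bałaban's UV stability UNCONDITIONAL — a real constructive-QFT result; it is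
NOT the continuum limit and NOT the Clay problem.»  HONEST DEPENDENCY (verbatim): «continuum YM on T⁴ ⇐ BetaPertH ∧ nine spine estimates (0/9 proved);
BetaPertH ⇐ (D1) ∧ (D4) ∧ CAP+tail; G-an2-4 gates asym, D1 and NE2/3/4.»

WHAT.  The weights of record are DEFINITIONS in the Literature scaffolding: `BalabanStepW2.wV4 d Lc j = (Lc^j)^{4(d+2)}`, `BalabanStepJetsSucc.wVH d Lc j =
(Lc^j)^{2(d+2)}`, `BalabanStepJetsSucc.wE d Lc j = (Lc^j)^{3(d+2)}`.  Hence, in units, `wV4·wVH = wE²` at EVERY `d`, `Lc`, `j` (`wV4_mul_wVH_eq_wE_sq`), and a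
"lock" `c·wV4·wVH = (a·wE)²` at ANY ONE level is the scalar equation `c = a²` (`lock_iff_of_level`, `Lc ≠ 0`).  Consequences:
* **`lock_iff_pinEq` (every `d`)**: `(∀ j, cE₂·wV4 d Lc (j+1)·wVH d Lc (j+1) = (Lc^{d+1}·wE d Lc (j+1))²) ↔ cE₂ = Lc^{2(d+1)}`.
* **`lock2_iff_pinEq` (`d = 3`)**: an2-g18's binder `hlock2` of `SpineRecursiveT2All.T2RecAt_bref_all_of_letters` (p216525, l.76 — TEXT VERBATIM:
  `∀ j, cE₂ * wV4 3 Lc (j + 1) * wVH 3 Lc (j + 1) = ((Lc : ℝ) ^ 4 * wE 3 Lc (j + 1)) ^ 2`) **⟺** `cE₂ = (Lc : ℝ) ^ (2 * (3 + 1))` — the TYPE of GAN24's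
  `hpinEq` (leaf-08-g20's `W3PinCountdown` p215945; ref2 r63∕r65∕r69∕r71); one level suffices (`pinEq_of_lock2_at`); conversely the pin gives the lock
  at EVERY level incl. `j = 0` (`lock2_of_pinEq`, `hlock2_of_pinEq`); the lock forces the SIGN OF RECORD `0 < cE₂` (`lock2_pos`, ref2 R55-3 `+`; the
  `−Lc⁸` branch is excluded) and the ≤-pin `|cE₂| ≤ Lc^{2(3+1)}` of leaf-12-g24's `T2ShapeThreeOfPin` (`abs_le_of_lock2`); an2's numeral currency
  `cE₂ = Lc^8` (`pinEq_iff_pow_eight`, `lock2_iff_pow_eight`).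
* **`t2ShapeDrift_three_an1_of_lock2`, `hW_hWall_three_an1_of_lock2` (∕ `_fromOne`)**: «T2Shape» ∧ «T2Drift» and THE D1 WALL's W-PAIR (`hW₂`, `hW₂all`)
  for an1's `WbalOf ∘ T2Of` (`d = 3`, `2 ≤ Lc`, any box root `r`, every colour tensor `Tc`, every other constant symbolic) **from an2's (W-L-2) lock
  ALONE** := `W3PinCountdown.…_of_pinEq … ((lock2_iff_pinEq cE₂).mp hlock2)` — ref2's `ref2_Wpair_of_lock2` as a tree theorem.

HONEST: IDENTIFICATION ONLY — NOTHING IS DISCHARGED.  The lock ∕ the pin is a HYPOTHESIS of every composed theorem below; by ref2's accounting rule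
(R73-1) lock and pin are ONE open row with two consumers (GAN24's W-pair by type; an2's D1 (L4) W-IND induction), never two residuals, and (W-L-2) may
not be waved through as «mechanical».  NOT the pin row (an2's (P6) ∕ owner's (w13) — untouched, not filed here); wall scoreboard unchanged: K 2∕2, S 2∕2,
W 0∕2 INSTANTIATED; NOT «W-slot closed» (first honest only when the pin row lands), NEVER «G-an2-4 closed», NOT (CONV-C); NOT D1, NOT `BetaPertH`, NOT
continuum, NOT Clay.  0 cited facts, 0 `def`, 0 `def … : Prop`, 0 sorry.  Unit `b2b-balaban-gan24-formalise-leaf-06` (G-an2-4 formalisation swarm, leaf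
prover 06, gen 12), 2026-08-20.
-/

noncomputable section

open Literature.MathematicalPhysics.QuantumFieldTheory
open Literature.MathematicalPhysics.QuantumFieldTheory.Balaban1983to89
open Literature.MathematicalPhysics.QuantumFieldTheory.Balaban1983to89.Beta
open AffineAveraging (box toSite)
open ExpKernelCalculus (VertexFamily₂)
open BalabanCompositeJets (LocStencil₂)
open BalabanStepW2 (T2Of WbalOf wV4)
open BalabanStepJetsSucc (wE wVH)
open AveragingMixedJetTables (vh₂S mixFFAt)
open Summit.QuantumFields.BalabanUV.Beta.HessKerDressedUnits (unitW)
open Summit.QuantumFields.BalabanUV.Beta.SecondOrderUnits (unitS₂)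
open Summit.QuantumFields.BalabanUV.Beta.GAN24.CombesThomas (sfStep smStep)
open Summit.QuantumFields.BalabanUV.Beta.GAN24.W3PinCountdown
  (t2ShapeDrift_three_an1_of_pinEq hW_hWall_three_an1_of_pinEq hW_hWall_three_an1_of_pinEq_fromOne)
open Summit.QuantumFields.BalabanUV.Beta.GAN24.T2ShapeThreeOfPin (abs_le_of_pinEq)

namespace Summit.QuantumFields.BalabanUV.Beta.GAN24.W3PinLock

/-! ## §1 Units: `wV4·wVH = wE²`, and a lock at one level is a scalar equation (every `d`) -/

section Units

variable (d Lc : ℕ) [NeZero Lc]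

omit [NeZero Lc] in
/-- [folklore] **THE UNITS IDENTITY** `wV4 d Lc j * wVH d Lc j = wE d Lc j ^ 2` at every `d`, `Lc`, `j`
(`4(d+2) + 2(d+2) = 2·3(d+2)` on the tree's weight DEFINITIONS `BalabanStepW2.wV4`, `BalabanStepJetsSucc.wVH`∕`wE`; no `Lc ≠ 0` needed). -/
theorem wV4_mul_wVH_eq_wE_sq (j : ℕ) : wV4 d Lc j * wVH d Lc j = wE d Lc j ^ 2 := by
  simp only [BalabanStepW2.wV4, BalabanStepJetsSucc.wVH, BalabanStepJetsSucc.wE]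
  ring

/-- [folklore] `wE d Lc j ≠ 0` (`Lc ≠ 0`). -/
theorem wE_ne_zero (j : ℕ) : wE d Lc j ≠ 0 := by
  simp only [BalabanStepJetsSucc.wE]
  exact pow_ne_zero _ (pow_ne_zero _ (Nat.cast_ne_zero.mpr (NeZero.ne Lc)))

/-- [folklore] **A LOCK AT ONE LEVEL IS A SCALAR EQUATION**: for any reals `c a` and any level `j`,
`c * wV4 d Lc j * wVH d Lc j = (a * wE d Lc j) ^ 2 ↔ c = a ^ 2` (cancel the nonzero `wE d Lc j ^ 2`). -/
theorem lock_iff_of_level (c a : ℝ) (j : ℕ) :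
    c * wV4 d Lc j * wVH d Lc j = (a * wE d Lc j) ^ 2 ↔ c = a ^ 2 := by
  rw [mul_assoc, wV4_mul_wVH_eq_wE_sq, mul_pow]
  exact mul_left_inj' (pow_ne_zero 2 (wE_ne_zero d Lc j))

/-- [folklore] **LOCK ⟺ PIN AT EVERY DIMENSION**: `(∀ j, cE₂ * wV4 d Lc (j+1) * wVH d Lc (j+1) = (Lc^(d+1) * wE d Lc (j+1))^2) ↔ cE₂ = Lc^(2*(d+1))`
(the `d`-generic form of ref2 R73-1; at `d = 3` it is `lock2_iff_pinEq`). -/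
theorem lock_iff_pinEq (cE₂ : ℝ) :
    (∀ j : ℕ, cE₂ * wV4 d Lc (j + 1) * wVH d Lc (j + 1) = ((Lc : ℝ) ^ (d + 1) * wE d Lc (j + 1)) ^ 2) ↔
      cE₂ = (Lc : ℝ) ^ (2 * (d + 1)) := by
  have hsq : ((Lc : ℝ) ^ (d + 1)) ^ 2 = (Lc : ℝ) ^ (2 * (d + 1)) := by
    rw [← pow_mul, mul_comm]
  constructor
  · intro h
    rw [← hsq]
    exact (lock_iff_of_level d Lc cE₂ ((Lc : ℝ) ^ (d + 1)) (0 + 1)).mp (h 0)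
  · intro h j
    exact (lock_iff_of_level d Lc cE₂ ((Lc : ℝ) ^ (d + 1)) (j + 1)).mpr (h.trans hsq.symm)

end Units

/-! ## §2 `d = 3`: an2's `hlock2` binder text VERBATIM ⟺ GAN24's `hpinEq` type VERBATIM -/

section Three

variable {Lc : ℕ} [NeZero Lc] {r : Fin (3 + 1) → ℕ}

/-- [folklore] `((Lc:ℝ)^4)^2 = (Lc:ℝ)^(2*(3+1))`. -/
theorem pow_four_sq_eq (Lc : ℕ) : ((Lc : ℝ) ^ 4) ^ 2 = (Lc : ℝ) ^ (2 * (3 + 1)) := by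
  rw [← pow_mul]

/-- [folklore] **ref2 R73-1 AS A TREE LEMMA — an2's (W-L-2) LOCK ⟺ THE EXACT PIN.**  The hypothesis text is an2-g18's binder `hlock2` of
`SpineRecursiveT2All.T2RecAt_bref_all_of_letters` (p216525 l.76) VERBATIM; the conclusion is the TYPE of GAN24's `hpinEq`
(`W3PinCountdown.hW_hWall_three_an1_of_pinEq`, p215945) VERBATIM.  ONE ROW, TWO CONSUMERS — an identification, NOT a discharge. -/
theorem lock2_iff_pinEq (cE₂ : ℝ) :
    (∀ j : ℕ, cE₂ * wV4 3 Lc (j + 1) * wVH 3 Lc (j + 1) = ((Lc : ℝ) ^ 4 * wE 3 Lc (j + 1)) ^ 2) ↔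
      cE₂ = (Lc : ℝ) ^ (2 * (3 + 1)) :=
  lock_iff_pinEq 3 Lc cE₂

/-- [folklore] **ONE LEVEL OF THE LOCK ALREADY PINS `cE₂`**: the lock equation at ANY single level `j` (incl. `j = 0`) gives `cE₂ = Lc^(2*(3+1))`. -/
theorem pinEq_of_lock2_at (cE₂ : ℝ) (j : ℕ)
    (h : cE₂ * wV4 3 Lc j * wVH 3 Lc j = ((Lc : ℝ) ^ 4 * wE 3 Lc j) ^ 2) : cE₂ = (Lc : ℝ) ^ (2 * (3 + 1)) := by
  rw [← pow_four_sq_eq]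
  exact (lock_iff_of_level 3 Lc cE₂ ((Lc : ℝ) ^ 4) j).mp h

/-- [folklore] **THE PIN GIVES THE LOCK AT EVERY LEVEL** (all `j`, not only the successor levels `j+1` of an2's binder). -/
theorem lock2_of_pinEq {cE₂ : ℝ} (hpinEq : cE₂ = (Lc : ℝ) ^ (2 * (3 + 1))) (j : ℕ) :
    cE₂ * wV4 3 Lc j * wVH 3 Lc j = ((Lc : ℝ) ^ 4 * wE 3 Lc j) ^ 2 :=
  (lock_iff_of_level 3 Lc cE₂ ((Lc : ℝ) ^ 4) j).mpr (hpinEq.trans (pow_four_sq_eq Lc).symm)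

/-- [folklore] **an2's binder from the pin** — the successor-level form `hlock2` consumed by `SpineRecursiveT2All` (p216525), from GAN24's `hpinEq`. -/
theorem hlock2_of_pinEq {cE₂ : ℝ} (hpinEq : cE₂ = (Lc : ℝ) ^ (2 * (3 + 1))) :
    ∀ j : ℕ, cE₂ * wV4 3 Lc (j + 1) * wVH 3 Lc (j + 1) = ((Lc : ℝ) ^ 4 * wE 3 Lc (j + 1)) ^ 2 :=
  fun j => lock2_of_pinEq hpinEq (j + 1)

/-- [folklore] numerals: `(Lc:ℝ)^(2*(3+1)) = (Lc:ℝ)^8` — the exponent of GAN24's `hpinEq` vs the numeral of an2's `Beta/SecondOrderLockPin` (p216648). -/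
theorem pow_pin_eq_pow_eight (Lc : ℕ) : (Lc : ℝ) ^ (2 * (3 + 1)) = (Lc : ℝ) ^ 8 := by
  norm_num

omit [NeZero Lc] in
/-- [folklore] **THE TWO PIN CURRENCIES AGREE**: `cE₂ = Lc^(2*(3+1)) ↔ cE₂ = Lc^8` (GAN24's `hpinEq` type ↔ an2's `SecondOrderLockPin` numeral). -/
theorem pinEq_iff_pow_eight (cE₂ : ℝ) : cE₂ = (Lc : ℝ) ^ (2 * (3 + 1)) ↔ cE₂ = (Lc : ℝ) ^ 8 := by
  rw [pow_pin_eq_pow_eight]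

/-- [folklore] **THE ∀-LOCK IN an2's NUMERAL CURRENCY**: `(∀ j, cE₂·wV4 3 Lc (j+1)·wVH 3 Lc (j+1) = (Lc⁴·wE 3 Lc (j+1))²) ↔ cE₂ = Lc^8` — the
∀-packaging of an2-g18's per-level lemma of record on the D1 side, `SpineRooted.lock2_iff` (`Beta/SecondOrderLockPin` p216648, landed 11:31Z, which
keeps naming precedence there), proved here independently over the weight DEFINITIONS so that GAN24-side consumers need not import the D1 spine chain;
where both modules are imported the two agree by `pinEq_iff_pow_eight`. -/
theorem lock2_iff_pow_eight (cE₂ : ℝ) :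
    (∀ j : ℕ, cE₂ * wV4 3 Lc (j + 1) * wVH 3 Lc (j + 1) = ((Lc : ℝ) ^ 4 * wE 3 Lc (j + 1)) ^ 2) ↔ cE₂ = (Lc : ℝ) ^ 8 :=
  (lock2_iff_pinEq cE₂).trans (pinEq_iff_pow_eight cE₂)

/-- [folklore] **THE LOCK FORCES THE SIGN OF RECORD**: `0 < cE₂` (ref2 R55-3 `+`; the `cE₂ = −Lc^8` branch — the oscillating case where «T2SupRate»
fails — is EXCLUDED under (W-L-2)). -/
theorem lock2_pos (cE₂ : ℝ)
    (hlock2 : ∀ j : ℕ, cE₂ * wV4 3 Lc (j + 1) * wVH 3 Lc (j + 1) = ((Lc : ℝ) ^ 4 * wE 3 Lc (j + 1)) ^ 2) : 0 < cE₂ := by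
  rw [(lock2_iff_pinEq cE₂).mp hlock2]
  exact pow_pos (Nat.cast_pos.mpr (Nat.pos_of_ne_zero (NeZero.ne Lc))) _

/-- [folklore] **THE LOCK GIVES THE ≤-PIN** `|cE₂| ≤ Lc^(2*(3+1))` — the hypothesis `hpin` of leaf-12-g24's `T2ShapeThreeOfPin.t2Shape_three_an1_of_hpin` ∕
`hW_three_an1_of_hpin` (END #1 «T2Shape» and the UNIFORM W-row need only the ≤-pin; the exact value is load-bearing on the drift ∕ Cauchy half). -/
theorem abs_le_of_lock2 (cE₂ : ℝ)
    (hlock2 : ∀ j : ℕ, cE₂ * wV4 3 Lc (j + 1) * wVH 3 Lc (j + 1) = ((Lc : ℝ) ^ 4 * wE 3 Lc (j + 1)) ^ 2) :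
    |cE₂| ≤ (Lc : ℝ) ^ (2 * (3 + 1)) :=
  abs_le_of_pinEq ((lock2_iff_pinEq cE₂).mp hlock2)

/-! ## §3 The W-slot ENDs and the D1 wall's W-pair at an1's table FROM an2's LOCK ALONE (composition BY NAME with `W3PinCountdown`) -/

/-- **«T2Shape» ∧ «T2Drift» AT an1's TABLE FROM an2's (W-L-2) LOCK ALONE** [folklore composition: leaf-08-g20's
`W3PinCountdown.t2ShapeDrift_three_an1_of_pinEq` at `hpinEq := (lock2_iff_pinEq cE₂).mp hlock2`]: `d = 3`, `2 ≤ Lc`, `r ∈ box (3+1) Lc`, every colour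
constant other than `cE₂` and the colour tensor `Tc` symbolic.  The lock is the ONE hypothesis and is UNDISCHARGED (an2's (P6)). -/
theorem t2ShapeDrift_three_an1_of_lock2 (hLc : 2 ≤ Lc) (hr : r ∈ box (3 + 1) Lc) (cE cVH cΛ cE₂ cB : ℝ)
    (Tc : Fin 4 → Fin 4 → Fin 4 → Fin 4 → ℝ)
    (hlock2 : ∀ j : ℕ, cE₂ * wV4 3 Lc (j + 1) * wVH 3 Lc (j + 1) = ((Lc : ℝ) ^ 4 * wE 3 Lc (j + 1)) ^ 2) :
    (∃ C₂ δ₂ : ℝ, 0 < δ₂ ∧ ∀ j, LocStencil₂ (unitS₂ (sfStep Lc j) (smStep 3 Lc j) (T2Of 3 Lc cE cVH cΛ cE₂ cB Tc (vh₂S 3 Lc) (mixFFAt (toSite r) Lc) j)) C₂ δ₂) ∧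
    (∃ c ϑ δT : ℝ, 0 ≤ c ∧ 0 < ϑ ∧ ϑ < 1 ∧ 0 < δT ∧
      (∀ n, LocStencil₂ (fun κ u κ' u' => unitS₂ (sfStep Lc (n + 1)) (smStep 3 Lc (n + 1)) (T2Of 3 Lc cE cVH cΛ cE₂ cB Tc (vh₂S 3 Lc) (mixFFAt (toSite r) Lc) (n + 1)) κ u κ' u' - unitS₂ (sfStep Lc n) (smStep 3 Lc n) (T2Of 3 Lc cE cVH cΛ cE₂ cB Tc (vh₂S 3 Lc) (mixFFAt (toSite r) Lc) n) κ u κ' u') (c * ϑ ^ n) δT) ∧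
      (∀ k j, LocStencil₂ (fun κ u κ' u' => unitS₂ (sfStep Lc (k + j)) (smStep 3 Lc (k + j)) (T2Of 3 Lc cE cVH cΛ cE₂ cB Tc (vh₂S 3 Lc) (mixFFAt (toSite r) Lc) (k + j)) κ u κ' u' - unitS₂ (sfStep Lc k) (smStep 3 Lc k) (T2Of 3 Lc cE cVH cΛ cE₂ cB Tc (vh₂S 3 Lc) (mixFFAt (toSite r) Lc) k) κ u κ' u') (c * (1 - ϑ)⁻¹ * ϑ ^ k) δT) ∧
      (∀ n κ u κ' u' x z a b, |unitS₂ (sfStep Lc (n + 1)) (smStep 3 Lc (n + 1)) (T2Of 3 Lc cE cVH cΛ cE₂ cB Tc (vh₂S 3 Lc) (mixFFAt (toSite r) Lc) (n + 1)) κ u κ' u' x z a b - unitS₂ (sfStep Lc n) (smStep 3 Lc n) (T2Of 3 Lc cE cVH cΛ cE₂ cB Tc (vh₂S 3 Lc) (mixFFAt (toSite r) Lc) n) κ u κ' u' x z a b| ≤ c * ϑ ^ n)) :=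
  t2ShapeDrift_three_an1_of_pinEq hLc hr cE cVH cΛ cE₂ cB Tc ((lock2_iff_pinEq cE₂).mp hlock2)

/-- **THE D1 WALL's W-PAIR AT an1's TABLE FROM an2's (W-L-2) LOCK ALONE, (R3′) chain of record** — `hW₂` (uniform `VertexFamily₂` row) ∧ `hW₂all`
(Cauchy row) for an2's normalised Stage-B family `unitW_j (WbalOf 3 Lc cE cVH cΛ (T2Of …) (mixFFAt (toSite r) Lc) j)` (ref2 r61 §D's literal text)
[folklore composition: `W3PinCountdown.hW_hWall_three_an1_of_pinEq` at `hpinEq := (lock2_iff_pinEq cE₂).mp hlock2`; = ref2 r73's `ref2_Wpair_of_lock2`].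
ONE ROW, TWO CONSUMERS: the residual hypothesis here IS an2's D1 (L4) binder `hlock2` BY TYPE.  UNDISCHARGED — NOT «W-slot closed». -/
theorem hW_hWall_three_an1_of_lock2 (hLc : 2 ≤ Lc) (hr : r ∈ box (3 + 1) Lc) (cE cVH cΛ cE₂ cB : ℝ)
    (Tc : Fin 4 → Fin 4 → Fin 4 → Fin 4 → ℝ)
    (hlock2 : ∀ j : ℕ, cE₂ * wV4 3 Lc (j + 1) * wVH 3 Lc (j + 1) = ((Lc : ℝ) ^ 4 * wE 3 Lc (j + 1)) ^ 2) :
    ∃ Cw cW θW δW : ℝ, 0 ≤ θW ∧ θW < 1 ∧ 0 < δW ∧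
      (∀ j, VertexFamily₂ (unitW (sfStep Lc j) (smStep 3 Lc j)
        (WbalOf 3 Lc cE cVH cΛ (T2Of 3 Lc cE cVH cΛ cE₂ cB Tc (vh₂S 3 Lc) (mixFFAt (toSite r) Lc)) (mixFFAt (toSite r) Lc) j)) Lc Cw δW) ∧
      (∀ k j, VertexFamily₂ (unitW (sfStep Lc (k + j)) (smStep 3 Lc (k + j))
        (WbalOf 3 Lc cE cVH cΛ (T2Of 3 Lc cE cVH cΛ cE₂ cB Tc (vh₂S 3 Lc) (mixFFAt (toSite r) Lc)) (mixFFAt (toSite r) Lc) (k + j)) -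
        unitW (sfStep Lc k) (smStep 3 Lc k)
        (WbalOf 3 Lc cE cVH cΛ (T2Of 3 Lc cE cVH cΛ cE₂ cB Tc (vh₂S 3 Lc) (mixFFAt (toSite r) Lc)) (mixFFAt (toSite r) Lc) k)) Lc (cW * θW ^ k) δW) :=
  hW_hWall_three_an1_of_pinEq hLc hr cE cVH cΛ cE₂ cB Tc ((lock2_iff_pinEq cE₂).mp hlock2)

/-- **THE SAME W-PAIR FROM THE LOCK BY THE (R1) CHAIN** [folklore composition: `W3PinCountdown.hW_hWall_three_an1_of_pinEq_fromOne` at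
`hpinEq := (lock2_iff_pinEq cE₂).mp hlock2`; states the same `Prop` as `hW_hWall_three_an1_of_lock2` (ref1 r35's `rfl` cross-check of the two pin chains)]. -/
theorem hW_hWall_three_an1_of_lock2_fromOne (hLc : 2 ≤ Lc) (hr : r ∈ box (3 + 1) Lc) (cE cVH cΛ cE₂ cB : ℝ)
    (Tc : Fin 4 → Fin 4 → Fin 4 → Fin 4 → ℝ)
    (hlock2 : ∀ j : ℕ, cE₂ * wV4 3 Lc (j + 1) * wVH 3 Lc (j + 1) = ((Lc : ℝ) ^ 4 * wE 3 Lc (j + 1)) ^ 2) :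
    ∃ Cw cW θW δW : ℝ, 0 ≤ θW ∧ θW < 1 ∧ 0 < δW ∧
      (∀ j, VertexFamily₂ (unitW (sfStep Lc j) (smStep 3 Lc j)
        (WbalOf 3 Lc cE cVH cΛ (T2Of 3 Lc cE cVH cΛ cE₂ cB Tc (vh₂S 3 Lc) (mixFFAt (toSite r) Lc)) (mixFFAt (toSite r) Lc) j)) Lc Cw δW) ∧
      (∀ k j, VertexFamily₂ (unitW (sfStep Lc (k + j)) (smStep 3 Lc (k + j))
        (WbalOf 3 Lc cE cVH cΛ (T2Of 3 Lc cE cVH cΛ cE₂ cB Tc (vh₂S 3 Lc) (mixFFAt (toSite r) Lc)) (mixFFAt (toSite r) Lc) (k + j)) -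
        unitW (sfStep Lc k) (smStep 3 Lc k)
        (WbalOf 3 Lc cE cVH cΛ (T2Of 3 Lc cE cVH cΛ cE₂ cB Tc (vh₂S 3 Lc) (mixFFAt (toSite r) Lc)) (mixFFAt (toSite r) Lc) k)) Lc (cW * θW ^ k) δW) :=
  hW_hWall_three_an1_of_pinEq_fromOne hLc hr cE cVH cΛ cE₂ cB Tc ((lock2_iff_pinEq cE₂).mp hlock2)

end Three

end Summit.QuantumFields.BalabanUV.Beta.GAN24.W3PinLock

end
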